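import Summits.RiemannHypothesis.RiemannHypothesis.Theorems.SemilocalLogAtomsE
import HarnessLib

/-!
# Log-atom enclosures (G): the atom `79`

Cell `rh-explicit` (HOME `run/shared/lean/pub/rh-explicit/`), seat cc-s2-4 gen9 (A4 lane, the Lean side).  Sequel of
`SemilocalLogAtoms{,B,C,D,E,F}.lean`: the rational enclosure `(lo, hi, wlo, whi)` of `log 79` and of the weight `log 79/√79`
needed by the negative certificate of the wall `q = 83` (`S = {p ≤ 79}`, window `b < (log 89)/2`, the second wall beyond every
measured one): `log 79` to 11 decimals from `79 = 80·(1 − 1/80)` (`Real.abs_log_sub_add_sum_range_le`, 7 terms, with `log 2`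
(d20) and `log 5`), `√79` by squaring; the window end `log 87 = log 3 + log 29` needs nothing new.

Folklore numerics throughout; nothing here bears on RH.
-/

set_option autoImplicit false
set_option linter.dupNamespace false  -- the mandated namespace repeats `RiemannHypothesis`

noncomputable section

namespace Summit.RiemannHypothesis.RiemannHypothesis.Theorems.SemilocalPolyWitness

open Real
open Literature.NumberTheory.LFunctions
open Literature.Analysis.SpecialFunctions.Real
open Summit.RiemannHypothesis.RiemannHypothesis.Theorems.MotivicDoor.SemilocalMarkov

/-! ### The atom `79` (`log 79` from `79 = 80·(1 − 1/80)`) -/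

/-- `(4.36944785236) < log 79` (`Real.abs_log_sub_add_sum_range_le` at `x = 1/80`, 7 terms). -/
theorem log_seventynine_gt : (4.36944785236 : ℝ) < Real.log 79 := by
  have t : |((1 : ℝ) / 80)| < 1 := by rw [abs_of_pos (by norm_num)]; norm_num
  have z := Real.abs_log_sub_add_sum_range_le t 7
  rw [abs_of_pos (by norm_num : (0 : ℝ) < 1 / 80)] at z
  norm_num [Finset.sum_range_succ] at z
  have e : Real.log (79 / 80) = Real.log 79 - (4 * Real.log 2 + Real.log 5) := by
    rw [Real.log_div (by norm_num) (by norm_num), show (80 : ℝ) = 2 ^ 4 * 5 by norm_num, Real.log_mul (by norm_num) (by norm_num), Real.log_pow]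
    push_cast; ring
  rw [e] at z
  have h2 := Literature.Analysis.SpecialFunctions.Real.log_two_gt_d20
  have h5 := logFiveLo_le
  rw [logFiveLo] at h5
  push_cast at h5
  obtain ⟨z1, z2⟩ := abs_le.1 z
  linarith

/-- `log 79 < 4.36944785257` (`Real.abs_log_sub_add_sum_range_le` at `x = 1/80`, 7 terms). -/
theorem log_seventynine_lt : Real.log 79 < 4.36944785257 := by
  have t : |((1 : ℝ) / 80)| < 1 := by rw [abs_of_pos (by norm_num)]; norm_num
  have z := Real.abs_log_sub_add_sum_range_le t 7
  rw [abs_of_pos (by norm_num : (0 : ℝ) < 1 / 80)] at z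
  norm_num [Finset.sum_range_succ] at z
  have e : Real.log (79 / 80) = Real.log 79 - (4 * Real.log 2 + Real.log 5) := by
    rw [Real.log_div (by norm_num) (by norm_num), show (80 : ℝ) = 2 ^ 4 * 5 by norm_num, Real.log_mul (by norm_num) (by norm_num), Real.log_pow]
    push_cast; ring
  rw [e] at z
  have h2 := Literature.Analysis.SpecialFunctions.Real.log_two_lt_d20
  have h5 := log_five_le_logFiveHi
  rw [logFiveHi] at h5
  push_cast at h5
  obtain ⟨z1, z2⟩ := abs_le.1 z
  linarith

/-- lower decimal of `log 79` -/
def logSeventyNineLo : ℚ := 436944785236 / 100000000000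
/-- upper decimal of `log 79` -/
def logSeventyNineHi : ℚ := 436944785257 / 100000000000
/-- `logSeventyNineLo ≤ log 79`. -/
theorem logSeventyNineLo_le : (logSeventyNineLo : ℝ) ≤ Real.log 79 := by
  rw [logSeventyNineLo]; push_cast; linarith [log_seventynine_gt]
/-- `log 79 ≤ logSeventyNineHi`. -/
theorem log_seventynine_le_logSeventyNineHi : Real.log 79 ≤ (logSeventyNineHi : ℝ) := by
  rw [logSeventyNineHi]; push_cast; linarith [log_seventynine_lt]
/-- `8.8881944173155888 ≤ √79 ≤ 8.8881944173155889`. -/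
def sqrtSeventyNineLo : ℚ := 88881944173155888 / 10000000000000000
/-- upper decimal of `√79` -/
def sqrtSeventyNineHi : ℚ := 88881944173155889 / 10000000000000000
/-- The atom `79`: weight `log 79/√79`. -/
def atomSeventyNine : ℕ × AtomQ :=
  (79, ⟨logSeventyNineLo, logSeventyNineHi, logSeventyNineLo / sqrtSeventyNineHi, logSeventyNineHi / sqrtSeventyNineLo⟩)
/-- `atomSeventyNine` encloses the atom `79` for any `S ∋ 79`. -/
theorem atomSeventyNine_encl {S : Finset ℕ} (h : 79 ∈ S) :
    (atomSeventyNine.2.lo : ℝ) ≤ Real.log atomSeventyNine.1 ∧ Real.log atomSeventyNine.1 ≤ (atomSeventyNine.2.hi : ℝ) ∧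
      (atomSeventyNine.2.wlo : ℝ) ≤ weilSemilocalCoeff S atomSeventyNine.1 ∧
      weilSemilocalCoeff S atomSeventyNine.1 ≤ (atomSeventyNine.2.whi : ℝ) := by
  simp only [atomSeventyNine]
  push_cast
  have h0 := prime_atom_encl (by norm_num : Nat.Prime 79) h (lo := logSeventyNineLo) (hi := logSeventyNineHi)
    (slo := sqrtSeventyNineLo) (shi := sqrtSeventyNineHi) (by exact_mod_cast logSeventyNineLo_le)
    (by exact_mod_cast log_seventynine_le_logSeventyNineHi) (by rw [logSeventyNineLo]; norm_num)
    (ratCast_le_sqrt (by rw [sqrtSeventyNineLo]; norm_num) (by rw [sqrtSeventyNineLo]; norm_num))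
    (sqrt_le_ratCast (by rw [sqrtSeventyNineHi]; norm_num) (by rw [sqrtSeventyNineHi]; norm_num))
    (by rw [sqrtSeventyNineLo]; norm_num)
  push_cast at h0
  exact h0

/-! ## Appendix (cc-s2-4 gen10, 2026-08-24): users

Documentation only — no declaration is added or changed (this re-commit also lets the hub build drain pick the module up:
accepted 2026-08-23T16:39Z, never built; OPS-REQUESTS 2026-08-24T01:09Z).

`atomSeventyNine` serves the wall rows `SemilocalNegCertUptoSeventyNine` (q = 83) and every later wall (`…UptoEightyThree` …
`…UptoHundredTwentySeven`, q = 89 … 131; atoms `83 … 128` follow in `SemilocalLogAtomsH/I/J/K.lean`).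
-/

end Summit.RiemannHypothesis.RiemannHypothesis.Theorems.SemilocalPolyWitness

end
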